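import Summits.Ventures.LatticeQCDFlow.TrivializingMaps.WilsonGradientBound
import Summits.Ventures.LatticeQCDFlow.TrivializingMaps.WilsonNonInteractingLinks
import Summits.Ventures.LatticeQCDFlow.TrivializingMaps.WilsonMeasureTrivializingMap
import Summits.Ventures.LatticeQCDFlow.TrivializingMaps.StaircaseMeanActionLaw
import Summits.Ventures.LatticeQCDFlow.TrivializingMaps.SuBasisExistence
import Summits.Ventures.LatticeQCDFlow.TrivializingMaps.HaarByPartsZeroModes
import Literature.MathematicalPhysics.QuantumFieldTheory.Luscher2010.FlowActionSeriesProofs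
import Literature.MathematicalPhysics.QuantumLattice.RepLieAlgebraUnitary
import Summits.Ventures.LatticeQCDFlow.Scaling.ExtensiveSpecificHeat
import Summits.Ventures.LatticeQCDFlow.Scaling.SchwingerDysonVarianceFloor
import HarnessLib

/-!
HONEST FRAMING: exact (Metropolis-corrected) sampling algorithms for lattice gauge theory; figures
of merit are autocorrelation/cost numbers at stated couplings and volumes; no continuum-physics
claim.

# WilsonSpecificHeatFloorShift — LATTICE TRANSLATIONS OF AMBIENT CONFIGURATIONS: THE MEAN LINK
# LAPLACIAN OF `S_W` DOES NOT DEPEND ON THE BASE POINT (theory2 item 128, PART 1 of 4: §A)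

CUSTODY: theory2 item 128 (GEN-41, HOME tier) re-landed by lean-2 GEN-10 per LEAD LINE 255 RL-47 (116);
statements and proofs = HOME/lean/theory2/WilsonSpecificHeatFloor.lean 07cab9e5ed9822d9 (1 031 l)
verbatim, split below the `lint.size` line into FOUR files (`WilsonSpecificHeatFloorShift` §A,
`WilsonSpecificHeatFloorDeriv` §B1–§B4, `WilsonSpecificHeatFloorCasimir` §C–§D,
`WilsonSpecificHeatFloor` §E–§F; parts 1–3 are mutually independent, part 4 imports them); headers
trimmed; imports = HOME's (its three `Scaling.*` placeholder lines ARE the tree module names of items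
125 / 126 / 127 as landed by lean-2 GEN-9) minus item 125, which only PART 4 §F needs; landing edits:
docstrings added where the lint asks (builder `build128.py` in the custodian's seat folder).

THEORY-2 item 128 (theory2 GEN-41; cell pub-lqcd / Ventures/LatticeQCDFlow).  Main theorem of the
series (`wilsonSpecificHeatFloorUniform`, PART 4): pure `SU(n)` Wilson theory on the torus `(ℤ/L)^d`;
for `n ≥ 2`, `d ≥ 2`, `β₀ > 0` there is `c = c(d, n, β₀) > 0` with
`Var_{π_u}(S_W) ≥ c · #plaquettes(d, L) / u²` for every `L ≥ 2` and every `u ≥ β₀` — item 125's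
conjecture (SH_W), uniform in the volume, hence item 125's `log² R` layer laws unconditional.

This part (§A = step (AVG) of the proof): torus translations `τ_v` act on ambient configurations
(`ambShift`; `coeConfig_torusConfigShift`), commute with link derivatives (`linkDeriv_comp_ambShift`)
and with item 127's directional Laplacians (`dirLap_comp_ambShift`), preserve `S_W`
(`ambWilsonAction_ambShift`) and the Wilson ensemble `π_β` (`integral_comp_torusConfigShift`, read from
the Literature `wilsonExpectation_comp_torusConfigShift`); hence `E_β[Δ_{(x,μ)} S_W]` does not depend
on the base point `x` (`integral_dirLap_shift`, `integral_dirLap_eq_origin`).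
-/

noncomputable section

set_option linter.unusedSectionVars false

namespace Summit.Ventures.LatticeQCDFlow.Theory2.WilsonSpecificHeat

open MeasureTheory ProbabilityTheory
open Literature.MathematicalPhysics.QuantumFieldTheory
open Literature.MathematicalPhysics.QuantumFieldTheory.Luscher2010
open Literature.MathematicalPhysics.QuantumFieldTheory.WilsonFlow (coeConfig continuous_coeConfig
  coeConfig_apply)
open Summit.Ventures.LatticeQCDFlow.TrivializingMaps
open Summit.Ventures.LatticeQCDFlow.Theory2.SchwingerDyson (dirLap)
open scoped Matrix Matrix.Norms.Frobenius ContDiff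

variable {d L n : ℕ}

/-! ## §A. Lattice translations of ambient configurations -/

section Shift

/-- Lattice translation of an ambient configuration: `(τ_v W)(x, μ) = W(x - v, μ)` (the ambient
counterpart of the tree's `torusConfigShift`). [folklore] -/
def ambShift (v : Site d L) (W : AmbConfig d L n) : AmbConfig d L n := fun e => W (e.1 - v, e.2)

/-- Pointwise formula for the translation `ambShift`. [folklore] -/
@[simp] theorem ambShift_apply (v : Site d L) (W : AmbConfig d L n) (e : Edge d L) :
    ambShift v W e = W (e.1 - v, e.2) := rfl

/-- `ι(τ_v U) = τ_v (ιU)`. [folklore] -/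
theorem coeConfig_torusConfigShift (v : Site d L)
    (U : GaugeConfig d L (Matrix.specialUnitaryGroup (Fin n) ℂ)) :
    coeConfig (torusConfigShift v U) = ambShift v (coeConfig U) := by
  funext e
  simp only [coeConfig_apply, torusConfigShift_apply, ambShift_apply]

/-- Translating an updated configuration updates the translated link. [folklore] -/
theorem ambShift_update (v : Site d L) (W : AmbConfig d L n) (x : Site d L) (μ : Fin d)
    (M : Matrix (Fin n) (Fin n) ℂ) :
    ambShift v (Function.update W (x, μ) M) = Function.update (ambShift v W) (x + v, μ) M := by
  funext e'
  obtain ⟨x', μ'⟩ := e'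
  simp only [ambShift_apply, Function.update_apply, Prod.mk.injEq]
  by_cases h : x' = x + v ∧ μ' = μ
  · obtain ⟨rfl, rfl⟩ := h
    simp
  · rw [if_neg h, if_neg]
    rintro ⟨h1, h2⟩
    exact h ⟨sub_eq_iff_eq_add.1 h1, h2⟩

/-- **Link derivatives are translation covariant**:
`∂_{(x,μ),X}(f ∘ τ_v)(W) = (∂_{(x+v,μ),X} f)(τ_v W)`. [folklore] -/
theorem linkDeriv_comp_ambShift (v : Site d L) (x : Site d L) (μ : Fin d)
    (X : Matrix (Fin n) (Fin n) ℂ) (f : AmbConfig d L n → ℝ) (W : AmbConfig d L n) :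
    linkDeriv (x, μ) X (fun W' => f (ambShift v W')) W =
      linkDeriv (x + v, μ) X f (ambShift v W) := by
  unfold linkDeriv
  have hW : ambShift v W (x + v, μ) = W (x, μ) := by simp
  simp only [ambShift_update, hW]

/-- The same, as an identity of functions. [folklore] -/
theorem linkDeriv_comp_ambShift' (v : Site d L) (x : Site d L) (μ : Fin d)
    (X : Matrix (Fin n) (Fin n) ℂ) (f : AmbConfig d L n → ℝ) :
    linkDeriv (x, μ) X (fun W' => f (ambShift v W')) =
      fun W => linkDeriv (x + v, μ) X f (ambShift v W) :=
  funext fun W => linkDeriv_comp_ambShift v x μ X f W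

variable [NeZero L]

/-- **Directional Laplacians are translation covariant.** [folklore] -/
theorem dirLap_comp_ambShift {ι : Type*} [Fintype ι] (Y : ι → Matrix (Fin n) (Fin n) ℂ)
    (f : AmbConfig d L n → ℝ) (v x : Site d L) (μ : Fin d) (W : AmbConfig d L n) :
    dirLap Y (fun W' => f (ambShift v W')) (x, μ) W = dirLap Y f (x + v, μ) (ambShift v W) := by
  unfold dirLap
  refine Finset.sum_congr rfl fun a _ => ?_
  rw [linkDeriv_comp_ambShift' v x μ (Y a) f, linkDeriv_comp_ambShift]

/-- **The Wilson action is translation invariant** (ambient form). [folklore] -/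
theorem ambWilsonAction_ambShift (v : Site d L) (W : AmbConfig d L n) :
    ambWilsonAction (ambShift v W) = ambWilsonAction W := by
  unfold ambWilsonAction
  refine Fintype.sum_equiv (Equiv.subRight v) _ _ fun x => ?_
  refine Finset.sum_congr rfl fun μ _ => Finset.sum_congr rfl fun ν _ => ?_
  simp only [ambShift_apply, Site.shift, add_sub_right_comm, Equiv.subRight_apply]

/-- As functions: `S_W ∘ τ_v = S_W`. [folklore] -/
theorem ambWilsonAction_comp_ambShift (v : Site d L) :
    (fun W : AmbConfig d L n => ambWilsonAction (ambShift v W)) = ambWilsonAction :=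
  funext fun W => ambWilsonAction_ambShift v W

/-- **Translation invariance of the Wilson ensemble** `π_β = 𝒵⁻¹e^{-βS_W}D[U]` (tree
`wilsonExpectation_comp_torusConfigShift`, read through the bridge
`boltzmannMeasure = wilsonMeasure`). [folklore] -/
theorem integral_comp_torusConfigShift (β : ℝ) (v : Site d L)
    (F : GaugeConfig d L (Matrix.specialUnitaryGroup (Fin n) ℂ) → ℝ) :
    ∫ U, F (torusConfigShift v U) ∂(boltzmannMeasure fun U :
        GaugeConfig d L (Matrix.specialUnitaryGroup (Fin n) ℂ) =>
          β * ambWilsonAction (coeConfig U)) =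
      ∫ U, F U ∂(boltzmannMeasure fun U :
        GaugeConfig d L (Matrix.specialUnitaryGroup (Fin n) ℂ) =>
          β * ambWilsonAction (coeConfig U)) := by
  rw [StrongCoupling.boltzmannMeasure_smul_ambWilsonAction β]
  have h := wilsonExpectation_comp_torusConfigShift (StrongCoupling.defRep n) β v F
  simpa only [wilsonExpectation, Function.comp_def] using h

/-- **The mean directional Laplacian of `S_W` does not depend on the base point of the link.**
[folklore] -/
theorem integral_dirLap_shift {ι : Type*} [Fintype ι] (Y : ι → Matrix (Fin n) (Fin n) ℂ) (β : ℝ)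
    (x v : Site d L) (μ : Fin d) :
    ∫ U, dirLap Y (ambWilsonAction : AmbConfig d L n → ℝ) (x + v, μ) (coeConfig U)
        ∂(boltzmannMeasure fun U : GaugeConfig d L (Matrix.specialUnitaryGroup (Fin n) ℂ) =>
          β * ambWilsonAction (coeConfig U)) =
      ∫ U, dirLap Y (ambWilsonAction : AmbConfig d L n → ℝ) (x, μ) (coeConfig U)
        ∂(boltzmannMeasure fun U : GaugeConfig d L (Matrix.specialUnitaryGroup (Fin n) ℂ) =>
          β * ambWilsonAction (coeConfig U)) := by
  have hpt : ∀ U : GaugeConfig d L (Matrix.specialUnitaryGroup (Fin n) ℂ),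
      dirLap Y (ambWilsonAction : AmbConfig d L n → ℝ) (x, μ) (coeConfig U) =
        dirLap Y (ambWilsonAction : AmbConfig d L n → ℝ) (x + v, μ)
          (coeConfig (torusConfigShift v U)) := by
    intro U
    rw [coeConfig_torusConfigShift, ← dirLap_comp_ambShift Y ambWilsonAction v x μ (coeConfig U),
      ambWilsonAction_comp_ambShift]
  calc ∫ U, dirLap Y (ambWilsonAction : AmbConfig d L n → ℝ) (x + v, μ) (coeConfig U)
        ∂(boltzmannMeasure fun U : GaugeConfig d L (Matrix.specialUnitaryGroup (Fin n) ℂ) =>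
          β * ambWilsonAction (coeConfig U))
      = ∫ U, dirLap Y (ambWilsonAction : AmbConfig d L n → ℝ) (x + v, μ)
          (coeConfig (torusConfigShift v U))
        ∂(boltzmannMeasure fun U : GaugeConfig d L (Matrix.specialUnitaryGroup (Fin n) ℂ) =>
          β * ambWilsonAction (coeConfig U)) :=
        (integral_comp_torusConfigShift β v (fun U => dirLap Y
          (ambWilsonAction : AmbConfig d L n → ℝ) (x + v, μ) (coeConfig U))).symm
    _ = ∫ U, dirLap Y (ambWilsonAction : AmbConfig d L n → ℝ) (x, μ) (coeConfig U)
        ∂(boltzmannMeasure fun U : GaugeConfig d L (Matrix.specialUnitaryGroup (Fin n) ℂ) =>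
          β * ambWilsonAction (coeConfig U)) :=
        integral_congr_ae (Filter.Eventually.of_forall fun U => (hpt U).symm)

/-- Hence the mean Laplacian of the link `(x, μ)` is that of `(0, μ)`. [folklore] -/
theorem integral_dirLap_eq_origin {ι : Type*} [Fintype ι] (Y : ι → Matrix (Fin n) (Fin n) ℂ)
    (β : ℝ) (x : Site d L) (μ : Fin d) :
    ∫ U, dirLap Y (ambWilsonAction : AmbConfig d L n → ℝ) (x, μ) (coeConfig U)
        ∂(boltzmannMeasure fun U : GaugeConfig d L (Matrix.specialUnitaryGroup (Fin n) ℂ) =>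
          β * ambWilsonAction (coeConfig U)) =
      ∫ U, dirLap Y (ambWilsonAction : AmbConfig d L n → ℝ) ((0 : Site d L), μ) (coeConfig U)
        ∂(boltzmannMeasure fun U : GaugeConfig d L (Matrix.specialUnitaryGroup (Fin n) ℂ) =>
          β * ambWilsonAction (coeConfig U)) := by
  have h := integral_dirLap_shift (n := n) Y β (0 : Site d L) x μ
  rw [zero_add] at h
  exact h

end Shift

end Summit.Ventures.LatticeQCDFlow.Theory2.WilsonSpecificHeat

end
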